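import Literature.Computability.Cryptography.CsidhGeneratorsOrderIdeals
import Literature.NumberTheory.LFunctions.AbelianFrobeniusDensity
import Mathlib.GroupTheory.Perm.Cycle.Type
import HarnessLib

/-!
# Characters of `cl(ℤ[√-p])` as ray class characters of `ℚ(√-p)` modulo `2`

Topic `Computability/Cryptography`; proof file (theorems only, no definition, no named fact),
sequel of `CsidhGeneratorsOrder.lean` / `CsidhGeneratorsOrderIdeals.lean`, towards the discharge of
`Literature.Computability.Cryptography.Csidh.jmv_smallPrimesGenerate` (`CsidhGenerators.lean`). This
is the content of Jao–Miller–Venkatesan 2009, Thm. 3.2 / Rem. 1.2(a) ("the class group `Cl(𝒪_D)`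
is a quotient of the narrow ray class group of `K = ℚ(√D)` relative to `𝔪`", `𝔪` the conductor;
Cox, *Primes of the form x² + ny²*, Prop. 7.22: `C(𝒪) ≅ I_K(f)/P_{K,ℤ}(f)`) in the form the tree's
class field theory consumes: for the map
`Φ : 𝔭 ↦ [𝔭 ∩ ℤ[√-p]] ∈ cl(ℤ[√-p])` on the primes of `𝓞 K` (any `Φ` with
`Φ v = classOf p (v.asIdeal.comap ι)`),

* `artinSymbol_eq_classOf_comap` — its multiplicative extension to ideals (the tree's
  `AbelianDensity.artinSymbol Φ`) is `𝔞 ↦ [𝔞 ∩ ℤ[√-p]]` on the ideals prime to `2`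
  (Cox, Prop. 7.20, multiplicativity: `CsidhGeneratorsOrder.comap_mul_of_odd_mem`);
* `artinKillsRay_two` — **it kills the ray modulo `(2)`** (`AbelianDensity.ArtinKillsRay`): for
  `b ≡ c (mod 2)` with `(c, 2) = 1`, choosing `c'` with `cc' ≡ 1 (mod 2)`, both `bc'` and `cc'` lie
  in `1 + 2𝓞 K ⊆ ι(ℤ[√-p])` and generate principal ideals of `ℤ[√-p]`, so
  `Φ((b)) Φ((c')) = 1 = Φ((c)) Φ((c'))` (Cox, Prop. 7.22: the kernel contains `P_{K,ℤ}(2) ⊇ P_{K,1}(2)`);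
  hence (`AbelianDensity.isRayClassCharacter_toMulHom`) every character of `cl(ℤ[√-p])` composed
  with `Φ` is a ray class character `mod (2)` (`LFunctions.IsRayClassCharacter`);
* `exists_apply_ne_one_of_ne_one` — a character of `cl(ℤ[√-p])` which is trivial on all `Φ(𝔭)`,
  `𝔭 ∤ 2`, is trivial (every class is `[𝔞 ∩ ℤ[√-p]]` for an ideal `𝔞` prime to `2`, Cox Cor. 7.17,
  and such `𝔞` factor into primes `𝔭 ∤ 2`);
* `apply_mem_smallPrimeClasses` — for a prime `𝔭 ∌ 2` of prime norm `ℓ ≤ x`, `Φ(𝔭)` is one of the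
  JMV generators `smallPrimeClasses p x` (`𝔭 ∩ ℤ[√-p] = (ℓ, t + √-p)`).

Also `odd_absNorm_of_isCoprime_two`: an ideal of `𝓞 K` prime to `2` has odd norm (Cauchy).

## References

* [JaoMillerVenkatesan2009] D. Jao, S. D. Miller, R. Venkatesan, J. Number Theory 129 (2009),
  Rem. 1.2(a) and Thm. 3.2 with its proof.
* [Cox2013] D. A. Cox, *Primes of the form x² + ny²*, 2nd ed., Wiley 2013, §7.C Prop. 7.20,
  Prop. 7.22, Cor. 7.17.
-/

noncomputable section

open scoped Classical nonZeroDivisors NumberField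

namespace Literature.Computability.Cryptography.Csidh

open Literature.NumberTheory.QuadraticFields.Quadratic
open Literature.NumberTheory.QuadraticFields.Quadratic.BinQF
open Literature.NumberTheory.LFunctions Literature.NumberTheory.LFunctions.AbelianDensity
open NumberField Module IsDedekindDomain

attribute [local instance] isDomain_zsqrtd_neg

variable (p : ℕ) [Fact p.Prime]
variable {K : Type*} [Field K] [NumberField K] (ι : ℤ√(-(p : ℤ)) →+* 𝓞 K)

/-! ### Ideals prime to `2` have odd norm -/

omit [Fact p.Prime] in
/-- **An ideal of `𝓞 K` coprime to `(2)` has odd absolute norm**: if `2 ∣ N(I) = #(𝓞 K / I)` there is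
a residue class `x̄ ≠ 0` with `2x̄ = 0` (Cauchy), while `1 ≡ 2t (mod I)` gives `x̄ = 2x̄ t̄ = 0`.
[folklore] -/
theorem odd_absNorm_of_isCoprime_two {I : Ideal (𝓞 K)} (h : IsCoprime I (Ideal.span {(2 : 𝓞 K)})) :
    Odd (Ideal.absNorm I) := by
  obtain ⟨i, hi, w, hw, hiw⟩ := Submodule.mem_sup.1
    ((Ideal.isCoprime_iff_sup_eq.1 h).symm ▸ Submodule.mem_top : (1 : 𝓞 K) ∈ I ⊔ Ideal.span {2})
  obtain ⟨t, rfl⟩ := Ideal.mem_span_singleton'.1 hw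
  have hI : I ≠ ⊥ := by
    rintro rfl
    rw [Ideal.mem_bot] at hi
    rw [hi, zero_add] at hiw
    have hu : IsUnit ((2 : ℤ) : 𝓞 K) := IsUnit.of_mul_eq_one_right t (by push_cast; exact hiw)
    have := isUnit_of_isUnit_intCast hu
    rcases Int.isUnit_iff.1 this with h | h <;> norm_num at h
  haveI : Finite (𝓞 K ⧸ I) := Ideal.finiteQuotientOfFreeOfNeBot I hI
  by_contra hodd
  rw [Nat.not_odd_iff_even, even_iff_two_dvd, Ideal.absNorm_apply, Submodule.cardQuot_apply] at hodd
  haveI : Fact (Nat.Prime 2) := ⟨Nat.prime_two⟩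
  obtain ⟨x, hx⟩ := exists_prime_addOrderOf_dvd_card' 2 hodd
  have hx2 : (2 : 𝓞 K ⧸ I) * x = 0 := by
    rw [two_mul, ← two_nsmul, ← hx, addOrderOf_nsmul_eq_zero]
  have hx0 : x ≠ 0 := by
    intro h0
    rw [h0, addOrderOf_zero] at hx
    norm_num at hx
  apply hx0
  have h1 : (Ideal.Quotient.mk I (t * 2)) = 1 := by
    rw [← (Ideal.Quotient.mk I).map_one, Ideal.Quotient.eq]
    rw [← hiw]
    simpa using I.neg_mem hi
  calc x = x * Ideal.Quotient.mk I (t * 2) := by rw [h1, mul_one]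
    _ = (2 : 𝓞 K ⧸ I) * x * Ideal.Quotient.mk I t := by rw [map_mul, map_ofNat]; ring
    _ = 0 := by rw [hx2, zero_mul]

omit [Fact p.Prime] in
/-- An element `z ≡ 1 (mod 2)` generates an ideal containing an odd natural number, its norm.
[folklore] -/
theorem exists_odd_mem_span_of_sub_one_mem {z : 𝓞 K} (hz : z - 1 ∈ Ideal.span {(2 : 𝓞 K)}) :
    ∃ N : ℕ, Odd N ∧ (N : 𝓞 K) ∈ Ideal.span {z} := by
  refine ⟨Ideal.absNorm (Ideal.span {z}), odd_absNorm_of_isCoprime_two ?_, Ideal.absNorm_mem _⟩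
  rw [Ideal.isCoprime_iff_exists]
  exact ⟨z, Ideal.mem_span_singleton_self z, -(z - 1), Submodule.neg_mem _ hz, by ring⟩

/-! ### The Artin symbol of `Φ` is `𝔞 ↦ [𝔞 ∩ ℤ[√-p]]` on ideals prime to `2` -/

variable (Φ : HeightOneSpectrum (𝓞 K) → ClassGroup (ℤ√(-(p : ℤ))))

omit [NumberField K] in
/-- The class of a nonzero principal ideal is trivial. [folklore] -/
theorem classOf_span_singleton {β : ℤ√(-(p : ℤ))} (hβ : β ≠ 0) :
    classOf p (Ideal.span {β}) = 1 := by
  have hβK : algebraMap (ℤ√(-(p : ℤ))) (FractionRing (ℤ√(-(p : ℤ)))) β ≠ 0 :=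
    (map_ne_zero_iff _ (IsFractionRing.injective (ℤ√(-(p : ℤ))) _)).2 hβ
  have hu : IsUnit ((Ideal.span {β} : Ideal (ℤ√(-(p : ℤ)))) :
      FractionalIdeal (ℤ√(-(p : ℤ)))⁰ (FractionRing (ℤ√(-(p : ℤ))))) := by
    rw [FractionalIdeal.coeIdeal_span_singleton]
    exact IsUnit.of_mul_eq_one _ (FractionalIdeal.spanSingleton_mul_inv (FractionRing _) hβK)
  rw [classOf_of_isUnit hu, ClassGroup.mk_eq_one_of_coe_ideal (I' := Ideal.span {β}) hu.unit_spec]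
  exact ⟨β, hβ, rfl⟩

omit [NumberField K] in
/-- `classOf ⊤ = 1`. [folklore] -/
theorem classOf_top : classOf p (⊤ : Ideal (ℤ√(-(p : ℤ)))) = 1 := by
  rw [← Ideal.span_singleton_one]
  exact classOf_span_singleton p one_ne_zero

/-- **The Artin symbol of `Φ` on ideals prime to `2`**: for a nonzero ideal `𝔞` of `𝓞 K` containing
an odd integer, `∏ Φ(𝔭)^{ν_𝔭(𝔞)} = [𝔞 ∩ ℤ[√-p]]` (induction on the factorisation of `𝔞`, using the
multiplicativity of `𝔞 ↦ 𝔞 ∩ ℤ[√-p]` on ideals prime to `2`, Cox Prop. 7.20, and of `classOf` on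
invertible ideals). [cite: Cox2013, §7.C Prop. 7.20] -/
theorem artinSymbol_eq_classOf_comap (h2 : finrank ℚ K = 2)
    (hΦ : ∀ v, Φ v = classOf p (v.asIdeal.comap ι)) {I : Ideal (𝓞 K)} (hI : I ≠ ⊥) {N : ℕ}
    (hN : Odd N) (hNI : (N : 𝓞 K) ∈ I) : artinSymbol Φ I = classOf p (I.comap ι) := by
  revert hI N
  refine UniqueFactorizationMonoid.induction_on_prime I (fun h => absurd rfl h) ?_ ?_
  · intro J hJ _ N _ _
    rw [Ideal.isUnit_iff] at hJ
    subst hJ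
    have h1 : artinSymbol Φ (⊤ : Ideal (𝓞 K)) = 1 := by
      have := artinSymbol_mul Φ (I := ⊤) (J := ⊤) top_ne_bot top_ne_bot
      rw [Ideal.top_mul] at this
      exact mul_eq_left.1 this.symm
    rw [h1, Ideal.comap_top, classOf_top]
  · intro J q hJ hq ih _ N hN hNI
    have hq0 : q ≠ ⊥ := hq.ne_zero
    haveI hqp : q.IsPrime := Ideal.isPrime_of_prime hq
    set v : HeightOneSpectrum (𝓞 K) := ⟨q, hqp, hq0⟩
    have hNq : (N : 𝓞 K) ∈ q := Ideal.mul_le_right hNI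
    have hNJ : (N : 𝓞 K) ∈ J := Ideal.mul_le_left hNI
    have hNq' : (N : ℤ√(-(p : ℤ))) ∈ q.comap ι := by rw [Ideal.mem_comap, map_natCast]; exact hNq
    have hNJ' : (N : ℤ√(-(p : ℤ))) ∈ J.comap ι := by rw [Ideal.mem_comap, map_natCast]; exact hNJ
    rw [artinSymbol_mul Φ hq0 hJ, ih hJ hN hNJ, show q = v.asIdeal from rfl, artinSymbol_asIdeal,
      hΦ, comap_mul_of_odd_mem p ι h2 hN hNq hN hNJ,
      classOf_mul p (isUnit_coe_of_odd_mem p hN hNq') (isUnit_coe_of_odd_mem p hN hNJ')]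

/-! ### `Φ` kills the ray modulo `(2)` -/

/-- If `x c' ≡ 1 (mod 2)` then `Φ((x)) Φ((c')) = 1`: `x c' ∈ 1 + 2𝓞 K ⊆ ι(ℤ[√-p])` generates a
principal ideal of `ℤ[√-p]` prime to the conductor. [cite: Cox2013, §7.C Prop. 7.22] -/
theorem artinSymbol_span_mul_eq_one (h2 : finrank ℚ K = 2)
    (hΦ : ∀ v, Φ v = classOf p (v.asIdeal.comap ι)) {x c' : 𝓞 K} (hx : x ≠ 0) (hc' : c' ≠ 0)
    (h1 : x * c' - 1 ∈ Ideal.span {(2 : 𝓞 K)}) :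
    artinSymbol Φ (Ideal.span {x}) * artinSymbol Φ (Ideal.span {c'}) = 1 := by
  have hx' : Ideal.span {x} ≠ ⊥ := by simpa [Ideal.span_singleton_eq_bot] using hx
  have hc'' : Ideal.span {c'} ≠ ⊥ := by simpa [Ideal.span_singleton_eq_bot] using hc'
  have hxc : x * c' ≠ 0 := mul_ne_zero hx hc'
  have hxc' : Ideal.span {x * c'} ≠ ⊥ := by simpa [Ideal.span_singleton_eq_bot] using hxc
  obtain ⟨N, hN, hNI⟩ := exists_odd_mem_span_of_sub_one_mem h1
  rw [← artinSymbol_mul Φ hx' hc'', Ideal.span_singleton_mul_span_singleton,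
    artinSymbol_eq_classOf_comap p ι Φ h2 hΦ hxc' hN hNI]
  -- `x c' = ι β` with `β ≡ 1 mod 𝔣'`
  obtain ⟨z, hz⟩ := Ideal.mem_span_singleton'.1 h1
  obtain ⟨w, hw⟩ := exists_emb_eq_two_mul p ι h2 z
  set β : ℤ√(-(p : ℤ)) := 1 + w with hβ
  have hβx : ι β = x * c' := by
    rw [hβ, map_add, map_one, hw]
    linear_combination hz
  have hβ0 : β ≠ 0 := by
    intro h0
    rw [h0, map_zero] at hβx
    exact hxc hβx.symm
  have hspan : Ideal.span {x * c'} = (Ideal.span {β}).map ι := by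
    rw [Ideal.map_span, Set.image_singleton, hβx]
  have hsup : Ideal.span {β} ⊔ (Ideal.span {(2 : 𝓞 K)}).comap ι = ⊤ := by
    rw [Ideal.eq_top_iff_one]
    have hwf : w ∈ (Ideal.span {(2 : 𝓞 K)}).comap ι := by
      rw [Ideal.mem_comap, hw]
      exact Ideal.mem_span_singleton'.2 ⟨z, by ring⟩
    have : (1 : ℤ√(-(p : ℤ))) = β - w := by rw [hβ]; ring
    rw [this]
    exact Submodule.sub_mem _ (Submodule.mem_sup_left (Ideal.mem_span_singleton_self β))
      (Submodule.mem_sup_right hwf)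
  rw [hspan, comap_map_eq_of_sup_eq_top p ι h2 hsup, classOf_span_singleton p hβ0]

/-- **`Φ` kills the ray modulo `(2)`** (`AbelianDensity.ArtinKillsRay (2) Φ`): for nonzero
`b ≡ c (mod 2)` with `(c, 2) = 1`, `Φ((b)) = Φ((c))` — the kernel of `I_K(2) → cl(ℤ[√-p])` contains
the ray `P_{K,1}(2)` (Cox, Prop. 7.22; JMV Thm. 3.2: `Cl(𝒪_D)` is a quotient of the ray class group
`mod 𝔪`). [cite: JaoMillerVenkatesan2009, Thm. 3.2 (proof)] -/
theorem artinKillsRay_two (h2 : finrank ℚ K = 2) (hΦ : ∀ v, Φ v = classOf p (v.asIdeal.comap ι)) :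
    ArtinKillsRay (Ideal.span {(2 : 𝓞 K)}) Φ := by
  intro b c hb hc hcop hbc _
  obtain ⟨u, hu, w, hw, huw⟩ := Submodule.mem_sup.1
    ((Ideal.isCoprime_iff_sup_eq.1 hcop).symm ▸ Submodule.mem_top :
      (1 : 𝓞 K) ∈ Ideal.span {c} ⊔ Ideal.span {2})
  obtain ⟨c', rfl⟩ := Ideal.mem_span_singleton'.1 hu
  obtain ⟨y, rfl⟩ := Ideal.mem_span_singleton'.1 hw
  have hc1 : c * c' - 1 ∈ Ideal.span {(2 : 𝓞 K)} :=
    Ideal.mem_span_singleton'.2 ⟨-y, by linear_combination -huw⟩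
  have hb1 : b * c' - 1 ∈ Ideal.span {(2 : 𝓞 K)} := by
    have : b * c' - 1 = (b - c) * c' + (c * c' - 1) := by ring
    rw [this]
    exact Ideal.add_mem _ (Ideal.mul_mem_right _ _ hbc) hc1
  have hc'0 : c' ≠ 0 := by
    rintro rfl
    rw [mul_zero, zero_sub, Ideal.neg_mem_iff, Ideal.mem_span_singleton'] at hc1
    obtain ⟨a, ha⟩ := hc1
    have hu : IsUnit ((2 : ℤ) : 𝓞 K) := IsUnit.of_mul_eq_one_right a (by push_cast; exact ha)
    have := isUnit_of_isUnit_intCast hu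
    rcases Int.isUnit_iff.1 this with h | h <;> norm_num at h
  have eb := artinSymbol_span_mul_eq_one p ι Φ h2 hΦ hb hc'0 hb1
  have ec := artinSymbol_span_mul_eq_one p ι Φ h2 hΦ hc hc'0 hc1
  exact mul_right_cancel (eb.trans ec.symm)

/-- Hence **every character of `cl(ℤ[√-p])`, composed with `Φ`, is a ray class character of `K`
modulo `(2)`** (JMV Rem. 1.2(a) with Thm. 3.2: characters of the quotient `Cl(𝒪_D)` of the ray class
group). [cite: JaoMillerVenkatesan2009, Rem. 1.2(a) and Thm. 3.2] -/
theorem isRayClassCharacter_toMulHom_comp (h2 : finrank ℚ K = 2)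
    (hΦ : ∀ v, Φ v = classOf p (v.asIdeal.comap ι))
    [Finite (ClassGroup (ℤ√(-(p : ℤ))))] (χ : AddChar (Additive (ClassGroup (ℤ√(-(p : ℤ))))) ℂ) :
    IsRayClassCharacter (Ideal.span {(2 : 𝓞 K)}) (fun v => toMulHom χ (Φ v)) :=
  isRayClassCharacter_toMulHom (artinKillsRay_two p ι Φ h2 hΦ) χ

/-! ### Nontriviality and the JMV generators -/

/-- **A character of `cl(ℤ[√-p])` trivial on all `Φ(𝔭)`, `𝔭 ∤ 2`, is trivial**: every class is
`[𝔞 ∩ ℤ[√-p]] = ∏ Φ(𝔭)^{ν_𝔭(𝔞)}` for an ideal `𝔞` of `𝓞 K` containing an odd integer (Cox Cor. 7.17),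
whose prime factors do not contain `2`. [cite: Cox2013, §7.C Cor. 7.17] -/
theorem exists_apply_ne_one_of_ne_one (h2 : finrank ℚ K = 2)
    (hΦ : ∀ v, Φ v = classOf p (v.asIdeal.comap ι)) {M : Type*} [CommMonoid M]
    (χ : ClassGroup (ℤ√(-(p : ℤ))) →* M) (hχ : χ ≠ 1) :
    ∃ v : HeightOneSpectrum (𝓞 K), (2 : 𝓞 K) ∉ v.asIdeal ∧ χ (Φ v) ≠ 1 := by
  by_contra hall
  push Not at hall
  apply hχ
  ext C
  rw [MonoidHom.one_apply]
  obtain ⟨𝔟, N, hN, hNb, -, hC⟩ := exists_odd_mem_classOf_eq p C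
  set I : Ideal (𝓞 K) := 𝔟.map ι with hIdef
  have hNI : (N : 𝓞 K) ∈ I := by
    have := Ideal.mem_map_of_mem ι hNb
    rwa [map_natCast] at this
  have hN0 : N ≠ 0 := fun h => by rw [h] at hN; exact Nat.not_odd_zero hN
  have hI : I ≠ ⊥ := by
    intro h
    rw [h, Ideal.mem_bot] at hNI
    exact hN0 (by exact_mod_cast hNI)
  have hcomap : I.comap ι = 𝔟 :=
    comap_map_eq_of_sup_eq_top p ι h2 (sup_comap_span_two_eq_top_of_odd_mem p ι hN hNb)
  rw [← hC, ← hcomap, ← artinSymbol_eq_classOf_comap p ι Φ h2 hΦ hI hN hNI, artinSymbol,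
    MonoidHom.map_finprod χ (mulSupport_artinSymbol_finite Φ hI)]
  refine finprod_eq_one_of_forall_eq_one fun v => ?_
  by_cases hcount : (Associates.mk v.asIdeal).count (Associates.mk I).factors = 0
  · rw [hcount, pow_zero, map_one]
  · -- `v ∣ I`, so `N ∈ v` and `2 ∉ v`
    have hdvd : v.asIdeal ∣ I := (Associates.count_ne_zero_iff_dvd hI v.irreducible).mp hcount
    have hNv : (N : 𝓞 K) ∈ v.asIdeal := Ideal.le_of_dvd hdvd hNI
    have h2v : (2 : 𝓞 K) ∉ v.asIdeal := by
      intro h2v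
      obtain ⟨k, hk⟩ := hN
      have : (1 : 𝓞 K) = N - k * 2 := by rw [hk]; push_cast; ring
      exact v.isPrime.ne_top ((Ideal.eq_top_iff_one _).2
        (this ▸ v.asIdeal.sub_mem hNv (v.asIdeal.mul_mem_left _ h2v)))
    rw [map_pow, hall v h2v, one_pow]

/-- **`Φ(𝔭)` is a JMV generator**: for a prime `𝔭 ∌ 2` of `𝓞 K` of prime norm `ℓ ≤ x`,
`Φ(𝔭) = [(ℓ, t + √-p)] ∈ smallPrimeClasses p x` (`𝔭 ∩ ℤ[√-p] = (ℓ, t + √-p)` with `ℓ ∣ t² + p`,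
`CsidhGeneratorsOrderIdeals.exists_comap_eq_primeIdeal`).
[cite: JaoMillerVenkatesan2009, Thm. 1.1 (the generating set `S_x`)] -/
theorem apply_mem_smallPrimeClasses (hΦ : ∀ v, Φ v = classOf p (v.asIdeal.comap ι))
    (v : HeightOneSpectrum (𝓞 K)) (h2v : (2 : 𝓞 K) ∉ v.asIdeal) {ℓ : ℕ} (hℓ : ℓ.Prime)
    (hv : Ideal.absNorm v.asIdeal = ℓ) {x : ℝ} (hx : (ℓ : ℝ) ≤ x) :
    Φ v ∈ smallPrimeClasses p x := by
  obtain ⟨t, hdvd, hcomap⟩ := exists_comap_eq_primeIdeal p ι v hℓ hv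
  have hℓ2 : ℓ ≠ 2 := by
    rintro rfl
    apply h2v
    have := Ideal.absNorm_mem v.asIdeal
    rw [hv] at this
    exact_mod_cast this
  exact ⟨ℓ, t, hℓ, hℓ2, hx, hdvd, by rw [hΦ, hcomap]⟩

end Literature.Computability.Cryptography.Csidh

end
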